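import Summits.NavierStokesRegularity.NavierStokesRegularity.Theorems.ScenarioCensusPressureMeterWork
import HarnessLib

/-!
# LINE «pressure-meter» REV 4 port, part 4/6: §C″ the generalised-head dial with a diffusion weight — the (θ, σ)-engine `rmod_le_window_head`, `norm_le_of_headWork`,
# `isTypeIAncientMild_two_mul_of_headWork`, `inner_convect_self_eq`

Re-homed for the scenario census (typer seat ns-census-typer-1 g8; the cells A1pe / A1p0 / A1pw / A1hw / A1bw / A1gw / A1ma / A1ac are MEMBERS OF RECORD «DECIDED IN
KERNEL IN FILES» of block A2 since census v1.73 (critic idea-crit-3 g7 PASS — no price 00:07:29Z on REV 3, RE-STAMP 00:39:59Z on REV 4; ref ns-census-ref g9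
PRE-CHECK ✓ §14.22 item 33 / §14.24 item 33′; lead-presearch label); this port makes them TREE-decided): VERBATIM PORT of ns-idea-2 LINE g13-3 «pressure-meter»
REV 4, `pub/ideators/ns-idea-2/lines/pressure-meter/line-pressure-meter.rev4.lean` sha16 7fb3f23e01caeb0c (1616 l., lean check rc 0, 0 sorry), split for the
400-line rule into `ScenarioCensusPressureMeter` (§A–§C engine) → `…PressureMeterForce` (§C end, §C′ start) → `…PressureMeterWork` (§C′ maximum principle) →
`…PressureMeterHead` (§C″) → `…PressureMeterRows` (§D rows, nestings) → `…PressureMeterCells` (§D holds + census KEYS).  Lean text VERBATIM in namespace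
`…Theorems.ScenarioCensus.PressureMeter` (the line's `…Lines.PressureMeter` re-homed); port edits: `local notation "E3"` → `abbrev E3` (typer lint: no notation in
port files), `@[conjecture]` on the OPEN rows `Row_A1pd` / `Row_A7s` (typed only, ∃-cells), seven one-line docstrings added (gate lint); `tendsto_typeI_bound`
(`C/√(-s) → 0`, twin of a landed tree lemma in a module the farm does not build — gate lint dedup.landed) is not re-declared and its three uses carry the
one-line Mathlib proof inline (proof text only); the line's `set_option maxHeartbeats 400000 in` on the (θ, σ)-engine is kept as filed.  Statements untouched.

No census VALUE is moved here (the members become TREE-decided by name); NS regularity is NOT proved; (L′) ⟨10661⟩ is untouched; no summit statement is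
proved by this file.
-/

-- the summit and its single problem share the name `NavierStokesRegularity` (D-0017 nested layout)
set_option linter.dupNamespace false

noncomputable section

open Set Function Filter Topology Metric

namespace Summit.NavierStokesRegularity.NavierStokesRegularity.Theorems.ScenarioCensus.PressureMeter

open Literature.Analysis Literature.Analysis.FluidPDE InnerProductSpace
open Summit.NavierStokesRegularity.NavierStokesRegularity.Theorems.SimilarityEnstrophy
  (typeI_ancient_eq_zero_of_rate_lt_one)
open scoped Laplacian InnerProductSpace RealInnerProductSpace ContDiff

/-! ## C″. The generalised-head dial (REV 3) with a diffusion weight (REV 4): the model operator `∂ₜ + θ u·∇ − σΔ` -/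

set_option maxHeartbeats 400000 in -- the (θ, σ)-engine: one long comparison proof (REV 4)
/-- **The generalised-head engine (REV 3/4).**  The comparison of `rmod_le_window` for the residual
`⟪u, ∂ₜu⟫ + θ ⟪u, (u·∇)u⟫ - σ ⟪u, Δu⟫ ≤ η‖u‖/((-t)√(-t))` with an ARBITRARY real weight `θ` on the
convective work and a diffusion weight `σ ≥ 0`: at a touching point the gradient condition still converts
`θ ⟪u, (u·∇)u⟫/ρ_κ = θ u·∇ρ_κ` into `θ` times the barrier's drift term, bounded by `|θ| V |∇barrier|` on the
window, and Kato's inequality times `σ` bounds `σ⟪u, Δu⟫/ρ_κ` by `σ Δ(barrier) = 6σc`, so the barrier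
exponent becomes `β = |θ| V + 6σ + 1` (`σ = 0`: pure transport, no Kato needed but harmless).  For `θ = 1` this is the streamline pressure work (`-u·∇p`), for
`θ = 0` the streamline work of the Bernoulli head (`-u·∇(p + |u|²/2)`, Lamb form: `⟪u, ω × u⟫ = 0`), in
general `-u·∇(p + (1-θ)|u|²/2)` since `⟪u, (u·∇)u⟫ = u·∇(|u|²/2)` (`inner_convect_self_eq`). -/
theorem rmod_le_window_head {C : ℝ} {u : ℝ → E3 → E3} (hu : IsTypeIAncientMild C u)
    (θ : ℝ) {σ : ℝ} (hσ : 0 ≤ σ) {η : ℝ} (hη : 0 ≤ η)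
    (hres : ∀ t < 0, ∀ x,
      ⟪u t x, deriv (fun τ => u τ x) t⟫ + θ * ⟪u t x, convect (u t) (u t) x⟫ -
          σ * ⟪u t x, (Δ (u t)) x⟫ ≤ η * ‖u t x‖ / ((-t) * Real.sqrt (-t)))
    {κ : ℝ} (hκ : 0 < κ) {s T : ℝ} (hsT : s < T) (hT : T < 0) :
    ∀ t ∈ Icc s T, ∀ x, rmod κ (u t) x ≤
      κ + C / Real.sqrt (-s) + 2 * η * ((Real.sqrt (-t))⁻¹ - (Real.sqrt (-s))⁻¹) := by
  have hs0 : s < 0 := hsT.trans hT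
  -- constants
  set V : ℝ := C / Real.sqrt (-T) with hV
  have hV0 : 0 ≤ V := div_nonneg hu.nonneg (Real.sqrt_nonneg _)
  have hVb : ∀ τ ∈ Icc s T, ∀ y, ‖u τ y‖ ≤ V := fun τ hτ y => norm_le_window hu hT hτ y
  set β : ℝ := |θ| * V + (6 * σ + 1) with hβ
  have hβ0 : 0 ≤ β := by rw [hβ]; linarith [mul_nonneg (abs_nonneg θ) hV0, hσ]
  set m : ℝ := C / Real.sqrt (-s) with hm
  have hm0 : 0 ≤ m := div_nonneg hu.nonneg (Real.sqrt_nonneg _)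
  -- the comparison function `F(t) = 2η (1/√(-t) - 1/√(-s))`
  set F : ℝ → ℝ := fun t => 2 * η * ((Real.sqrt (-t))⁻¹ - (Real.sqrt (-s))⁻¹) with hF
  have hFderiv : ∀ t < 0, HasDerivAt F (η / ((-t) * Real.sqrt (-t))) t := by
    intro t ht
    have h := ((hasDerivAt_inv_sqrt_neg ht).sub_const ((Real.sqrt (-s))⁻¹)).const_mul (2 * η)
    refine h.congr_deriv ?_
    have hnt : 0 < -t := neg_pos.2 ht
    have hsq : 0 < Real.sqrt (-t) := Real.sqrt_pos.2 hnt
    have hne : (-t) * Real.sqrt (-t) ≠ 0 := by positivity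
    field_simp
  have hFnonneg : ∀ t ∈ Icc s T, 0 ≤ F t := by
    intro t ht
    have ht0 : t < 0 := lt_of_le_of_lt ht.2 hT
    have h1 : Real.sqrt (-t) ≤ Real.sqrt (-s) := Real.sqrt_le_sqrt (by linarith [ht.1])
    have h2 : 0 < Real.sqrt (-t) := Real.sqrt_pos.2 (by linarith)
    have h3 : (Real.sqrt (-s))⁻¹ ≤ (Real.sqrt (-t))⁻¹ := inv_anti₀ h2 h1
    have : 0 ≤ (Real.sqrt (-t))⁻¹ - (Real.sqrt (-s))⁻¹ := sub_nonneg.2 h3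
    positivity
  have hFs : F s = 0 := by simp [hF]
  -- smoothness data of the class
  have hsm : IsSmoothSpaceTimeOn (Iio 0) u := hu.1
  have huC2 : ∀ t < 0, ContDiff ℝ 2 (u t) := fun t ht =>
    (hu.contDiff_slice ht).of_le (by norm_cast)
  have hud : ∀ t < 0, ∀ x, DifferentiableAt ℝ (u t) x := fun t ht x =>
    ((huC2 t ht).of_le one_le_two).differentiable one_ne_zero x
  have hut : ∀ t < 0, ∀ x, HasDerivAt (fun τ => u τ x) (deriv (fun τ => u τ x) t) t := by
    intro t ht x
    exact ((hsm.differentiableWithinAt_time (mem_Iio.2 ht) x).differentiableAt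
      (Iio_mem_nhds ht)).hasDerivAt
  -- the claim for every `ε > 0`, on every large ball
  suffices key : ∀ ε : ℝ, 0 < ε → ∀ R : ℝ, V / ε ≤ R →
      ∀ t ∈ Icc s T, ∀ x ∈ closedBall (0 : E3) R,
        rmod κ (u t) x - ((κ + m + F t) + ε * Real.exp (β * (t - s)) * (1 + ‖x‖ ^ 2)) ≤ 0 by
    intro t ht x
    refine le_of_forall_pos_le_add fun δ hδ => ?_
    set A : ℝ := Real.exp (β * (t - s)) * (1 + ‖x‖ ^ 2) with hA
    have hApos : 0 < A := by positivity
    have h := key (δ / A) (div_pos hδ hApos) (max (V / (δ / A)) ‖x‖) (le_max_left _ _) t ht x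
      (mem_closedBall_zero_iff.2 (le_max_right _ _))
    have e1 : δ / A * Real.exp (β * (t - s)) * (1 + ‖x‖ ^ 2) = δ := by
      rw [hA]; field_simp
    rw [e1] at h
    simp only [hm, hF] at h ⊢
    linarith
  intro ε hε R hR
  have hR0 : 0 ≤ R := le_trans (div_nonneg hV0 hε.le) hR
  -- the comparison function and its time derivative
  set w : ℝ → E3 → ℝ := fun t x =>
    rmod κ (u t) x - ((κ + m + F t) + ε * Real.exp (β * (t - s)) * (1 + ‖x‖ ^ 2)) with hw
  set wₜ : ℝ → E3 → ℝ := fun t x =>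
    ⟪u t x, deriv (fun τ => u τ x) t⟫ / rmod κ (u t) x -
      (η / ((-t) * Real.sqrt (-t)) + β * (ε * Real.exp (β * (t - s)) * (1 + ‖x‖ ^ 2))) with hwₜ
  set K : Set E3 := closedBall 0 R with hK
  set U : Set E3 := ball 0 R with hU
  have hKc : IsCompact K := isCompact_closedBall _ _
  have hUo : IsOpen U := isOpen_ball
  have hUK : U ⊆ K := ball_subset_closedBall
  -- (a) joint continuity on `[s, T] × K`
  have hc : ContinuousOn (uncurry w) (Icc s T ×ˢ K) := by
    have hsub : Icc s T ×ˢ K ⊆ Iio (0 : ℝ) ×ˢ (univ : Set E3) :=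
      prod_mono (fun t ht => lt_of_le_of_lt ht.2 hT) (subset_univ _)
    have huc : ContinuousOn (uncurry u) (Icc s T ×ˢ K) := hsm.continuousOn.mono hsub
    have h1 : ContinuousOn (fun p : ℝ × E3 => Real.sqrt (κ ^ 2 + ‖uncurry u p‖ ^ 2))
        (Icc s T ×ˢ K) := (continuousOn_const.add (huc.norm.pow 2)).sqrt
    have hsqrt : ContinuousOn (fun p : ℝ × E3 => (Real.sqrt (-p.1))⁻¹) (Icc s T ×ˢ K) := by
      refine ContinuousOn.inv₀ (by fun_prop) ?_
      intro p hp
      have : p.1 < 0 := lt_of_le_of_lt hp.1.2 hT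
      exact (Real.sqrt_pos.2 (by linarith)).ne'
    have h2 : ContinuousOn (fun p : ℝ × E3 =>
        (κ + m + 2 * η * ((Real.sqrt (-p.1))⁻¹ - (Real.sqrt (-s))⁻¹)) +
          ε * Real.exp (β * (p.1 - s)) * (1 + ‖p.2‖ ^ 2)) (Icc s T ×ˢ K) := by
      have h3 : ContinuousOn (fun p : ℝ × E3 => ε * Real.exp (β * (p.1 - s)) * (1 + ‖p.2‖ ^ 2))
          (Icc s T ×ˢ K) := by fun_prop
      exact (continuousOn_const.add (continuousOn_const.mul (hsqrt.sub continuousOn_const))).add h3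
    refine (h1.sub h2).congr fun p _ => ?_
    simp only [hw, hF, uncurry, rmod_apply, Pi.sub_apply]
  -- (b) smooth slices
  have h2 : ∀ t ∈ Ioc s T, ContDiff ℝ 2 (w t) := by
    intro t ht
    have ht0 : t < 0 := lt_of_le_of_lt ht.2 hT
    exact (contDiff_rmod hκ (huC2 t ht0)).sub
      (contDiff_barrier (κ + m + F t) (ε * Real.exp (β * (t - s))))
  -- (c) the left time derivative
  have ht : ∀ t ∈ Ioc s T, ∀ x ∈ U, HasDerivWithinAt (fun τ => w τ x) (wₜ t x) (Icc s t) t := by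
    intro t ht x _
    have ht0 : t < 0 := lt_of_le_of_lt ht.2 hT
    have h_n : HasDerivAt (fun τ => κ ^ 2 + ‖u τ x‖ ^ 2)
        (2 * ⟪u t x, deriv (fun τ => u τ x) t⟫) t :=
      (hut t ht0 x).norm_sq.const_add (κ ^ 2)
    have hne : κ ^ 2 + ‖u t x‖ ^ 2 ≠ 0 := by positivity
    have h_rho : HasDerivAt (fun τ => rmod κ (u τ) x)
        (⟪u t x, deriv (fun τ => u τ x) t⟫ / rmod κ (u t) x) t := by
      have h := h_n.sqrt hne
      have hfun : (fun τ => rmod κ (u τ) x) = fun τ => Real.sqrt (κ ^ 2 + ‖u τ x‖ ^ 2) := rfl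
      rw [hfun]
      refine h.congr_deriv ?_
      have hs : Real.sqrt (κ ^ 2 + ‖u t x‖ ^ 2) ≠ 0 := (Real.sqrt_pos.2 (by positivity)).ne'
      rw [rmod_apply]
      field_simp
    have h_exp : HasDerivAt (fun τ => ε * Real.exp (β * (τ - s)) * (1 + ‖x‖ ^ 2))
        (β * (ε * Real.exp (β * (t - s)) * (1 + ‖x‖ ^ 2))) t := by
      have h1 : HasDerivAt (fun τ => Real.exp (β * (τ - s))) (Real.exp (β * (t - s)) * β) t := by
        have := (((hasDerivAt_id t).sub_const s).const_mul β).exp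
        simpa using this
      have h2 := (h1.const_mul ε).mul_const (1 + ‖x‖ ^ 2)
      refine h2.congr_deriv ?_
      ring
    have h_all := h_rho.sub (((hFderiv t ht0).const_add (κ + m)).add h_exp)
    simp only [hw, hwₜ]
    exact h_all.hasDerivWithinAt
  -- (d) the sub-solution implication, from Kato's inequality and the residual inequality
  have hsub : ∀ t ∈ Ioc s T, ∀ x ∈ U, fderiv ℝ (w t) x = 0 → (Δ (w t)) x ≤ 0 → wₜ t x ≤ 0 := by
    intro t ht x hx hgrad hlap
    have ht0 : t < 0 := lt_of_le_of_lt ht.2 hT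
    have htI : t ∈ Icc s T := ⟨ht.1.le, ht.2⟩
    set c : ℝ := ε * Real.exp (β * (t - s)) with hc
    have hc0 : 0 < c := by positivity
    have hρ0 : 0 < rmod κ (u t) x := rmod_pos hκ _ _
    have hden : 0 < (-t) * Real.sqrt (-t) := by
      have : 0 < -t := neg_pos.2 ht0
      positivity
    -- elementary estimates for the barrier budget
    set A : ℝ := c * (1 + ‖x‖ ^ 2) with hA
    have hA0 : 0 ≤ A := by positivity
    have hx2 : 2 * (‖x‖ * V) ≤ V * (1 + ‖x‖ ^ 2) := by
      nlinarith [sq_nonneg (‖x‖ - 1), norm_nonneg x]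
    have hx2' : c * (2 * (‖x‖ * V)) ≤ V * A := by
      calc c * (2 * (‖x‖ * V)) ≤ c * (V * (1 + ‖x‖ ^ 2)) := mul_le_mul_of_nonneg_left hx2 hc0.le
        _ = V * A := by rw [hA]; ring
    have hx2θ : |θ| * (c * (2 * (‖x‖ * V))) ≤ |θ| * (V * A) :=
      mul_le_mul_of_nonneg_left hx2' (abs_nonneg θ)
    have h6 : σ * (6 * c) ≤ (6 * σ + 1) * A := by
      have hpos : 0 ≤ c * ‖x‖ ^ 2 := by positivity
      have hcA : c ≤ A := by
        have e1 : A = c + c * ‖x‖ ^ 2 := by rw [hA]; ring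
        rw [e1]; linarith
      have h1 : σ * (6 * c) ≤ σ * (6 * A) := mul_le_mul_of_nonneg_left (by linarith) hσ
      have e2' : (6 * σ + 1) * A = σ * (6 * A) + A := by ring
      rw [e2']; linarith
    have e2 : β * A = |θ| * (V * A) + (6 * σ + 1) * A := by rw [hβ]; ring
    -- the drift term (class velocity bound on the window)
    have hconv : -(|θ| * (c * (2 * (‖x‖ * V)))) ≤ θ * (c * (2 * ⟪x, u t x⟫)) := by
      have h1 : |⟪x, u t x⟫| ≤ ‖x‖ * ‖u t x‖ := abs_real_inner_le_norm _ _
      have h2 : ‖x‖ * ‖u t x‖ ≤ ‖x‖ * V :=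
        mul_le_mul_of_nonneg_left (hVb t htI x) (norm_nonneg _)
      have h3 : |θ * (c * (2 * ⟪x, u t x⟫))| ≤ |θ| * (c * (2 * (‖x‖ * V))) := by
        have e1 : |θ * (c * (2 * ⟪x, u t x⟫))| = |θ| * (c * (2 * |⟪x, u t x⟫|)) := by
          rw [abs_mul θ, abs_mul c, abs_mul (2 : ℝ), abs_of_pos hc0, abs_two]
        rw [e1]
        exact mul_le_mul_of_nonneg_left (mul_le_mul_of_nonneg_left
          (mul_le_mul_of_nonneg_left (h1.trans h2) zero_le_two) hc0.le) (abs_nonneg θ)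
      exact (abs_le.1 h3).1
    have f4 : -(rmod κ (u t) x * (|θ| * (c * (2 * (‖x‖ * V))))) ≤
        θ * (rmod κ (u t) x * (c * (2 * ⟪x, u t x⟫))) := by
      have h := mul_le_mul_of_nonneg_left hconv hρ0.le
      rw [mul_neg] at h
      have e1 : rmod κ (u t) x * (θ * (c * (2 * ⟪x, u t x⟫))) =
          θ * (rmod κ (u t) x * (c * (2 * ⟪x, u t x⟫))) := by ring
      linarith
    -- derivative of `w t`: the gradient condition at the touching point
    have hB := hasFDerivAt_barrier (κ + m + F t) c x
    have hI := hasFDerivAt_rmod hκ (hud t ht0 x)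
    have hwderiv : HasFDerivAt (w t)
        ((rmod κ (u t) x)⁻¹ • ((innerSL ℝ (u t x) : E3 →L[ℝ] ℝ).comp (fderiv ℝ (u t) x)) -
          c • ((2 : ℕ) • (innerSL ℝ x : E3 →L[ℝ] ℝ))) x := by
      have h := hI.sub hB
      simp only [hw, hc]
      exact h
    have hDeq : (rmod κ (u t) x)⁻¹ • ((innerSL ℝ (u t x) : E3 →L[ℝ] ℝ).comp (fderiv ℝ (u t) x)) =
        c • ((2 : ℕ) • (innerSL ℝ x : E3 →L[ℝ] ℝ)) := by
      have := hwderiv.fderiv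
      rw [hgrad] at this
      exact (sub_eq_zero.1 this.symm)
    have hDapply : (rmod κ (u t) x)⁻¹ * ⟪u t x, fderiv ℝ (u t) x (u t x)⟫ =
        c * (2 * ⟪x, u t x⟫) := by
      have := congrArg (fun L : E3 →L[ℝ] ℝ => L (u t x)) hDeq
      simpa [innerSL_apply_apply, nsmul_eq_mul] using this
    have f2 : ⟪u t x, fderiv ℝ (u t) x (u t x)⟫ = rmod κ (u t) x * (c * (2 * ⟪x, u t x⟫)) := by
      rw [← hDapply, ← mul_assoc, mul_inv_cancel₀ hρ0.ne', one_mul]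
    -- Laplacians: the barrier absorbs `Δρ_κ ≤ 6c`, Kato converts it to `⟪u, Δu⟫ ≤ 6c ρ_κ`
    have hΔeq : (Δ (w t)) x = (Δ (rmod κ (u t))) x - 6 * c := by
      have h1 : ContDiffAt ℝ 2 (rmod κ (u t)) x := (contDiff_rmod hκ (huC2 t ht0)).contDiffAt
      have h2' : ContDiffAt ℝ 2 (fun y : E3 => ((κ + m + F t) + c * (1 + ‖y‖ ^ 2) : ℝ)) x :=
        (contDiff_barrier (κ + m + F t) c).contDiffAt
      have h4 := h1.laplacian_sub h2'
      have hfun : w t = (rmod κ (u t)) -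
          fun y : E3 => ((κ + m + F t) + c * (1 + ‖y‖ ^ 2) : ℝ) := by
        funext y
        simp only [hw, hc, Pi.sub_apply]
      rw [hfun, h4, laplacian_barrier]
    have hΔρ : (Δ (rmod κ (u t))) x ≤ 6 * c := by
      rw [hΔeq] at hlap; linarith
    have f3 : ⟪u t x, (Δ (u t)) x⟫ ≤ rmod κ (u t) x * (6 * c) :=
      (inner_laplacian_le_rmod_mul_laplacian hκ (huC2 t ht0) x).trans
        (mul_le_mul_of_nonneg_left hΔρ hρ0.le)
    have f3σ : σ * ⟪u t x, (Δ (u t)) x⟫ ≤ rmod κ (u t) x * (σ * (6 * c)) :=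
      calc σ * ⟪u t x, (Δ (u t)) x⟫ ≤ σ * (rmod κ (u t) x * (6 * c)) :=
            mul_le_mul_of_nonneg_left f3 hσ
        _ = rmod κ (u t) x * (σ * (6 * c)) := by ring
    -- the speed ratio `|u|/ρ_κ ≤ 1` on the forcing
    have f1 : η * ‖u t x‖ / ((-t) * Real.sqrt (-t)) ≤
        η * rmod κ (u t) x / ((-t) * Real.sqrt (-t)) :=
      div_le_div_of_nonneg_right (mul_le_mul_of_nonneg_left (norm_le_rmod κ (u t) x) hη) hden.le
    -- the residual inequality at `(t, x)`
    have hr := hres t ht0 x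
    rw [convect_apply, f2] at hr
    have hP : ⟪u t x, deriv (fun τ => u τ x) t⟫ ≤
        (η / ((-t) * Real.sqrt (-t)) + β * A) * rmod κ (u t) x := by
      have g1 : ⟪u t x, deriv (fun τ => u τ x) t⟫ ≤
          η * rmod κ (u t) x / ((-t) * Real.sqrt (-t)) +
            rmod κ (u t) x * (|θ| * (c * (2 * (‖x‖ * V)))) +
              rmod κ (u t) x * (σ * (6 * c)) := by
        linarith [hr, f1, f3σ, f4]
      have g2 : |θ| * (c * (2 * (‖x‖ * V))) + σ * (6 * c) ≤ β * A := by linarith [hx2θ, h6, e2]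
      calc ⟪u t x, deriv (fun τ => u τ x) t⟫
          ≤ η * rmod κ (u t) x / ((-t) * Real.sqrt (-t)) +
              rmod κ (u t) x * (|θ| * (c * (2 * (‖x‖ * V)))) +
                rmod κ (u t) x * (σ * (6 * c)) := g1
        _ = (η / ((-t) * Real.sqrt (-t)) + (|θ| * (c * (2 * (‖x‖ * V))) + σ * (6 * c))) *
              rmod κ (u t) x := by
            ring
        _ ≤ (η / ((-t) * Real.sqrt (-t)) + β * A) * rmod κ (u t) x :=
            mul_le_mul_of_nonneg_right (by linarith [g2]) hρ0.le
    -- conclude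
    have e3 : wₜ t x = ⟪u t x, deriv (fun τ => u τ x) t⟫ / rmod κ (u t) x -
        (η / ((-t) * Real.sqrt (-t)) + β * A) := by
      simp only [hwₜ, hA, hc]
    rw [e3, sub_nonpos, div_le_iff₀ hρ0]
    exact hP
  -- (e) the parabolic boundary: `t = s`
  have hbot : ∀ x ∈ K, w s x ≤ 0 := by
    intro x _
    have h1 : rmod κ (u s) x ≤ κ + m := by
      calc rmod κ (u s) x ≤ κ + ‖u s x‖ := rmod_le hκ.le _ _
        _ ≤ κ + m := by rw [hm]; linarith [hu.norm_le hs0 x]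
    have h3 : 0 ≤ ε * Real.exp (β * (s - s)) * (1 + ‖x‖ ^ 2) := by positivity
    simp only [hw]
    rw [hFs]
    linarith
  -- (f) the parabolic boundary: the sphere `|x| = R`
  have hlat : ∀ t ∈ Icc s T, ∀ x ∈ K \ U, w t x ≤ 0 := by
    intro t ht' x hx
    have hxK : ‖x‖ ≤ R := mem_closedBall_zero_iff.1 hx.1
    have hxR : ‖x‖ = R := by
      have hnot : x ∉ ball (0 : E3) R := hx.2
      have : R ≤ ‖x‖ := by simpa using hnot
      exact le_antisymm hxK this
    have hexp1 : 1 ≤ Real.exp (β * (t - s)) :=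
      Real.one_le_exp (mul_nonneg hβ0 (by linarith [ht'.1]))
    have hH : ε * (1 + ‖x‖ ^ 2) ≤ ε * Real.exp (β * (t - s)) * (1 + ‖x‖ ^ 2) := by
      have : ε * (1 + ‖x‖ ^ 2) * 1 ≤ ε * (1 + ‖x‖ ^ 2) * Real.exp (β * (t - s)) :=
        mul_le_mul_of_nonneg_left hexp1 (by positivity)
      linarith
    have h1 : rmod κ (u t) x ≤ κ + V := by
      calc rmod κ (u t) x ≤ κ + ‖u t x‖ := rmod_le hκ.le _ _
        _ ≤ κ + V := by linarith [hVb t ht' x]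
    have h2 : V ≤ ε * (1 + ‖x‖ ^ 2) := by
      rw [hxR]
      have hεR : V ≤ ε * R := by rwa [div_le_iff₀' hε] at hR
      nlinarith [sq_nonneg (R - 1), hε.le]
    have hF0 := hFnonneg t ht'
    simp only [hw]
    linarith
  intro t ht' x hx
  have h := weak_max_principle hKc hUo hUK hc h2 ht hsub hbot hlat t ht' x hx
  simpa only [hw] using h

/-- **The generalised-head maximum principle** (`κ → 0`, `s → -∞`): residual level `η ≥ 0` with
convective weight `θ` ⇒ `‖u(t, x)‖ ≤ 2η/√(-t)`. -/
theorem norm_le_of_headWork {C : ℝ} {u : ℝ → E3 → E3} (hu : IsTypeIAncientMild C u)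
    (θ : ℝ) {σ : ℝ} (hσ : 0 ≤ σ) {η : ℝ} (hη : 0 ≤ η)
    (hres : ∀ t < 0, ∀ x,
      ⟪u t x, deriv (fun τ => u τ x) t⟫ + θ * ⟪u t x, convect (u t) (u t) x⟫ -
          σ * ⟪u t x, (Δ (u t)) x⟫ ≤ η * ‖u t x‖ / ((-t) * Real.sqrt (-t))) :
    ∀ t < 0, ∀ x, ‖u t x‖ ≤ 2 * η / Real.sqrt (-t) := by
  intro t ht x
  refine le_of_forall_pos_le_add fun κ hκ => ?_
  have hev : ∀ᶠ s in atBot, ‖u t x‖ ≤ C / Real.sqrt (-s) + (2 * η / Real.sqrt (-t) + κ) := by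
    filter_upwards [Iio_mem_atBot t] with s hs
    have h := rmod_le_window_head hu θ hσ hη hres hκ hs ht t ⟨hs.le, le_rfl⟩ x
    have h0 := norm_le_rmod κ (u t) x
    have h1 : 0 ≤ (Real.sqrt (-s))⁻¹ := inv_nonneg.2 (Real.sqrt_nonneg _)
    have h2 : 2 * η * ((Real.sqrt (-t))⁻¹ - (Real.sqrt (-s))⁻¹) ≤ 2 * η / Real.sqrt (-t) := by
      rw [div_eq_mul_inv]
      nlinarith
    linarith
  have hlim : Tendsto (fun s : ℝ => C / Real.sqrt (-s) + (2 * η / Real.sqrt (-t) + κ)) atBot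
      (𝓝 (0 + (2 * η / Real.sqrt (-t) + κ))) := ((show Tendsto (fun s : ℝ => C / Real.sqrt (-s)) atBot (𝓝 0) from (Real.tendsto_sqrt_atTop.comp tendsto_neg_atBot_atTop).const_div_atTop C)).add_const _
  rw [zero_add] at hlim
  exact ge_of_tendsto hlim hev

/-- A class element with generalised-head work level `η` (any weight `θ`) has Type-I constant `2η`. -/
theorem isTypeIAncientMild_two_mul_of_headWork {C : ℝ} {u : ℝ → E3 → E3}
    (hu : IsTypeIAncientMild C u) (θ : ℝ) {σ : ℝ} (hσ : 0 ≤ σ) {η : ℝ} (hη : 0 ≤ η)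
    (hres : ∀ t < 0, ∀ x,
      ⟪u t x, deriv (fun τ => u τ x) t⟫ + θ * ⟪u t x, convect (u t) (u t) x⟫ -
          σ * ⟪u t x, (Δ (u t)) x⟫ ≤ η * ‖u t x‖ / ((-t) * Real.sqrt (-t))) :
    IsTypeIAncientMild (2 * η) u :=
  ⟨hu.1, hu.2.1, hu.2.2.1, fun t ht x => norm_le_of_headWork hu θ hσ hη hres t ht x⟩

/-- `⟪U, (U·∇)U⟫ = ½ (U·∇)|U|²`: the convective work is the streamline derivative of the kinetic
energy, so `⟪u, ∂ₜu⟫ + θ⟪u, (u·∇)u⟫ - ⟪u, Δu⟫ = -u·∇(p + (1 - θ)|u|²/2)` along a classical solution. -/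
theorem inner_convect_self_eq {U : E3 → E3} {y : E3} (hU : DifferentiableAt ℝ U y) :
    ⟪U y, convect U U y⟫ = (1 / 2 : ℝ) * fderiv ℝ (fun z => ‖U z‖ ^ 2) y (U y) := by
  rw [convect_apply, hU.hasFDerivAt.norm_sq.fderiv]
  simp [innerSL_apply_apply]

end Summit.NavierStokesRegularity.NavierStokesRegularity.Theorems.ScenarioCensus.PressureMeter

end
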